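import Summits.HodgeConjecture.HodgeConjecture.Theorems.F0P3cStCharTSWeylHypMeasure     -- ★ p849733∕p849841 (B) radial Weyl formula (this seat)
import Summits.HodgeConjecture.HodgeConjecture.Theorems.F0P3cStCharTSTorusChartIso        -- ★ p849607 `torusChartEquiv`, `torusChart` (LH6-p01); brings ★ p849564 `TorusDefs` (`hyperbolicSet`)
import Literature.NumberTheory.Automorphic.TorusOrbitalDescentCanonical                     -- ★ S0 `map_descConj_id_centralizer_quotientMeasure_eq_map_symm_of_mulEquiv`
import Literature.NumberTheory.Automorphic.OrbitalMeasureCanonicalAtPoint                   -- ★ `IsCanonical.classOrbitalIntegral_mk_eq_orbitalIntegral'`, `eq_of_apply_compactCore_eq_one`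
import Literature.NumberTheory.Automorphic.OrbitalMeasureCanonicalExistsCM                  -- ★ `forall_isRegularElt_exists_isHaarMeasure_compactCore_centralizer_local_eq_one`
import Literature.NumberTheory.Automorphic.LocalUnitaryGroupCongr                           -- ★ `isUnit_antidiagOne_det`
import Literature.NumberTheory.Automorphic.LocalUnitaryIntegralLevel                          -- ★ `antidiagOne_map_transpose`
import HarnessLib

/-!
# F0 · P3c · line LH6 «StCharTS» — «WIF-HYP COROLLARY★»: THE WEYL INTEGRATION FORMULA ON THE HYPERBOLIC SET IN THE ROAD'S CURRENCY
# (canonical orbital integrals `classOrbitalIntegral mQv`, the named set `hyperbolicSet L v`, the torus in parameter form `M = E_vˣ × E¹_v`)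

Cell `pub/hodgecm-mathlib`, crux H413 = `stmt-HodgeConjecture-24833` (lane `--supports`, helper); seat LH2-p02 (g3); brick «WIF-HYP COROLLARY★» = item 1 of
LH6-p01 (g2)'s `CENSUS-WM-HM.v1.md` §4 («the ONE brick the next edition waits on»), agreed 06:08:13Z.  Sequel of ★ p849733 (radial Weyl formula on the
hyperbolic set, unconditional).  THEOREMS ONLY; sorry-free; no definition ∕ instance ∕ notation; axioms TRIO.

WHAT THIS FILE ADDS (the GLUE the integrator flagged under (W-b)): (i) the passage «canonical orbital integral at a regular `t ∈ T` = fibre integral of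
`q ↦ φ(Φ(q,t))` against `ν∕tT`» for the canonical family `mQv` (★ `IsCanonical`) and THE Haar measure `tT` of `T` with mass one on the compact core; (ii) the
existence of that `tT` on the split torus; (iii) the radial Weyl formula of ★ p849733 RE-READ against canonical orbital integrals and a radial measure on `T`,
then on the parameter torus `M = E_vˣ × E¹_v` through ★ `torusChartEquiv`, with the hyperbolic set spelled ★ `hyperbolicSet L v`.

* §1 (generic: `G` l.c. second countable T₂, `T ≤ G` closed, `t ∈ T` with `Z(t) = T`) **`orbitalIntegral_eq_integral_conjFamily_of_centralizer_eq`** —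
  `O_t(φ; ν∕tZ) = ∫_{G⧸T} φ(Φ(q, t)) d(ν∕tT)` when `tT` is `tZ` read on `T` (★ S0 transport at `Ψ = id`).
* §2 (CM, `v` non-split) **`exists_haar_cmTorus_compactCore_eq_one`** — a Haar measure on `T` that is inversion invariant with mass `1` on `compactCore T`
  (★ `forall_isRegularElt_exists_isHaarMeasure_compactCore_centralizer_local_eq_one` at a regular `t₀`, read on `T = Z(t₀)`, ★ (B0));
  **`classOrbitalIntegral_mk_eq_integral_conjFamily`** — for `mQv` canonical and `t ∈ T^{reg}`:
  `classOrbitalIntegral mQv φ ⟦t⟧ = ∫_{G⧸T} φ(Φ(q,t)) d(ν∕tT)` (★ `IsCanonical.classOrbitalIntegral_mk_eq_orbitalIntegral'` + §1).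
* §3 (CM) **`hyperbolicSet_eq_hypSet`** — ★ `hyperbolicSet L v` IS the set `Ω` of ★ p849733∕★ (B1); **`exists_radialMeasure_integral_mul_classFun`** —
  «(WIF-σ)»: there is a measure `σ′` on `T`, finite on compact sets, σ-finite, carried by `T^{reg}`, such that for every measurable `α` that is conjugation
  invariant on `Ω` and every `φ` with `φ · α` ν-integrable on `Ω` and `φ = 0` off `Ω`:
  **`∫ φ·α dν = ∫_T classOrbitalIntegral mQv φ ⟦t⟧ · α(t) dσ′(t)`**; **`exists_radialMeasure_integral_mul_classFun_param`** — the same on the parameter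
  torus: `∫ φ·α dν = ∫_M classOrbitalIntegral mQv φ ⟦ι m⟧ · α(ι m) dσ_M(m)`, `ι = torusChart L v`, `σ_M := (torusChartEquiv L v)⁻¹_* σ′`.

* §4 (ED. 2) **`exists_radialMeasure_wif`**, **`exists_radialMeasure_wif_param`** — §3 in the binder shape of the leaf's (WIF) socket (★ p849901
  `…SaHeadTorus3`): `α` measurable, locally `ν`-integrable, conjugation invariant on `hyperbolicSet L v`; `φ` with `IsLocSmooth φ`, `tsupport φ ⊆ hyperbolicSet L v`.

HONEST LABEL.  (WIF-σ) is (W-b) of the census WITH A RADIAL MEASURE in place of a density `ρ · μM`: the density form needs `σ ≪ μM`, i.e. the Jacobian of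
conjugation [HarishChandra1970, L. 22], which is the conditional ★ p849811 (B-jac) and is NOT asserted here.  Count-neutral; closes no organ.  HC_CM is proved only
modulo the 7 printed citations (2 remaining: hLiu418 = `stmt-HodgeConjecture-24832`, h413 = `stmt-HodgeConjecture-24833`) until rung 0 closes.

## References
* [Rogawski1990] J. D. Rogawski, *Automorphic Representations of Unitary Groups in Three Variables*, Ann. of Math. Stud. 123 (1990), §12.5 p. 182; §4.3 (4.3.1)
  p. 43; §4.9 p. 54.
* [HarishChandra1970] Harish-Chandra, *Harmonic analysis on reductive p-adic groups*, LNM 162 (1970), Lemma 42 (and Lemma 22).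
* [DeitmarEchterhoff2014] A. Deitmar, S. Echterhoff, *Principles of Harmonic Analysis*, 2nd ed. (2014), Thm. 1.5.3.
* [vanDijk1972] G. van Dijk, *Computation of certain induced characters of p-adic groups*, Math. Ann. 199 (1972) 229–240, §2.
-/

set_option autoImplicit false
set_option linter.dupNamespace false

noncomputable section

open MeasureTheory Measure Set Filter Topology Function NumberField IsDedekindDomain Matrix Polynomial
open Literature.MeasureTheory.Group
open Literature.NumberTheory.Automorphic Literature.NumberTheory.Automorphic.UnitaryGroup Literature.NumberTheory.Rogawski1990
open Summit.HodgeConjecture.HodgeConjecture.Cruxes.H413.F0P3cStCharTSWeylHypFibre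
open Summit.HodgeConjecture.HodgeConjecture.Cruxes.H413.F0P3cStCharTSWeylHypTorsor
open Summit.HodgeConjecture.HodgeConjecture.Cruxes.H413.F0P3cStCharTSWeylHypCM
open Summit.HodgeConjecture.HodgeConjecture.Cruxes.H413.F0P3cStCharTSWeylHypMeasure
open Summit.HodgeConjecture.HodgeConjecture.Cruxes.H413.F0P3cStCharTSTorusDefs
open Summit.HodgeConjecture.HodgeConjecture.Cruxes.H413.F0P3cStCharTSTorusChartIso
open scoped ENNReal NNReal MatrixGroups Pointwise

namespace Summit.HodgeConjecture.HodgeConjecture.Cruxes.H413.F0P3cStCharTSWeylHypWIF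

universe u

/-! ## §1 Generic: the orbital integral against `ν∕t_Z` at `t` with `Z(t) = T`, read on `G ⧸ T` -/

section Generic

variable {G : Type u} [Group G] [TopologicalSpace G] [IsTopologicalGroup G] [LocallyCompactSpace G] [T2Space G]
  [SecondCountableTopology G] [MeasurableSpace G] [BorelSpace G]

/-- **`O_t(φ; ν∕t_Z) = ∫_{G ⧸ T} φ(Φ(q, t)) d(ν∕t_T)(q)` when `Z(t) = T`** (as subgroups) and `t_T` is `t_Z` read on `T`: the orbital integral of ★
`LocalOrbitalIntegral` at `t` against the quotient measure by a Haar measure `t_Z` of the centraliser equals the fibre integral of the conjugation family over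
`G ⧸ T` — ★ S0 `map_descConj_id_centralizer_quotientMeasure_eq_map_symm_of_mulEquiv` at `Ψ = id` (the two quotient types `G ⧸ Z(t)` and `G ⧸ T` carry their
own Borel σ-algebras; the orbit MEASURES on `G` coincide). [cite: DeitmarEchterhoff2014, Thm. 1.5.3] [cite: Rogawski1990, §4.3 (4.3.1) p. 43; §4.9 p. 54] -/
theorem orbitalIntegral_eq_integral_conjFamily_of_centralizer_eq
    (T : Subgroup G) (hT : IsClosed (T : Set G)) [MeasurableSpace (G ⧸ T)] [BorelSpace (G ⧸ T)]
    (ν : Measure G) [ν.IsHaarMeasure] [ν.IsMulRightInvariant]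
    (tT : Measure ↥T) [tT.IsHaarMeasure] [tT.IsInvInvariant]
    (Φ : (G ⧸ T) × ↥T → G) (hΦ : ∀ (x : G) (t : ↥T), Φ (QuotientGroup.mk x, t) = x * t * x⁻¹)
    (t : ↥T) (hZ : ∀ g : G, (MulEquiv.refl G) g ∈ T ↔ g ∈ Subgroup.centralizer ({(t : G)} : Set G))
    [MeasurableSpace (G ⧸ Subgroup.centralizer ({(t : G)} : Set G))] [BorelSpace (G ⧸ Subgroup.centralizer ({(t : G)} : Set G))]
    (tZ : Measure ↥(Subgroup.centralizer ({(t : G)} : Set G))) [tZ.IsHaarMeasure] [tZ.IsInvInvariant]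
    (htZ : tT = Measure.map (subgroupCongrHomeomorph (MulEquiv.refl G) (Subgroup.centralizer ({(t : G)} : Set G)) T hZ
      continuous_id continuous_id) tZ)
    (φ : G → ℂ) (hφ : Measurable φ) :
    orbitalIntegral (t : G) φ
        (quotientMeasure (Subgroup.centralizer ({(t : G)} : Set G)) tZ (isClosed_coe_centralizer_singleton (t : G)) ν) =
      ∫ q, φ (Φ (q, t)) ∂(quotientMeasure T tT hT ν) := by
  have ht' : ∀ a ∈ T, a * (MulEquiv.refl G) (t : G) = (MulEquiv.refl G) (t : G) * a := fun a ha =>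
    (Subgroup.mem_centralizer_iff.1 ((hZ a).1 ha) (t : G) (mem_singleton _)).symm
  have hν : ν = Measure.map (MulEquiv.refl G) ν := by
    rw [MulEquiv.coe_refl, Measure.map_id]
  have key := map_descConj_id_centralizer_quotientMeasure_eq_map_symm_of_mulEquiv hT ν tT (MulEquiv.refl G)
    continuous_id continuous_id (t : G) hZ ν hν tZ htZ ht'
  replace key := key.trans Measure.map_id
  have hdZ : Measurable (descConj (t : G) (Subgroup.centralizer ({(t : G)} : Set G))
      (fun _ hg => Subgroup.mem_centralizer_singleton_iff.1 hg) (id : G → G)) :=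
    measurable_descConj _ _ _ measurable_id
  have hdT : Measurable (descConj ((MulEquiv.refl G) (t : G)) T ht' (id : G → G)) := measurable_descConj _ _ _ measurable_id
  rw [orbitalIntegral_eq_integral_descConj, descConj_eq_comp]
  change ∫ y, φ (descConj (t : G) (Subgroup.centralizer ({(t : G)} : Set G)) _ id y) ∂_ = _
  rw [← integral_map hdZ.aemeasurable hφ.aestronglyMeasurable, key, integral_map hdT.aemeasurable hφ.aestronglyMeasurable]
  refine integral_congr_ae (Eventually.of_forall fun q => ?_)
  induction q using QuotientGroup.induction_on with
  | H x => simp only [descConj_mk, hΦ]; rfl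

end Generic

/-! ## §2 The CM carrier: the normalised Haar measure of `T` and canonical orbital integrals as fibre integrals -/

section CM

variable (L : Type) [Field L] [NumberField L] [IsCMField L] (v : HeightOneSpectrum (𝓞 ↥(maximalRealSubfield L)))

/-- **The split torus `T` of `U(Φ₃)(L⁺_v)` carries a Haar measure, inversion invariant, with mass `1` on its compact core** (every finite `v`): `T = Z(t₀)` for a
regular `t₀ ∈ T` (★ (B0) `exists_mem_torusU_isRegularElt`, `centralizer_eq_cmTorus_of_isRegularElt`), and ★
`forall_isRegularElt_exists_isHaarMeasure_compactCore_centralizer_local_eq_one` provides the measure on `Z(t₀)`. [cite: Rogawski1990, §4.3 (4.3.1) p. 43; §1.7 p. 6] -/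
theorem exists_haar_cmTorus_compactCore_eq_one
    [MeasurableSpace ↥(unitaryGroupOfForm (conjLocal L (IsCMField.complexConj L) v) (cmLocalForm L 3 v))] [BorelSpace ↥(unitaryGroupOfForm (conjLocal L (IsCMField.complexConj L) v) (cmLocalForm L 3 v))] :
    ∃ tT : Measure ↥(cmBorelTriple L 3 v).M, tT.IsHaarMeasure ∧ tT.IsInvInvariant ∧ tT (compactCore ↥(cmBorelTriple L 3 v).M) = 1 := by
  obtain ⟨t₀, ht₀, hreg₀⟩ := exists_mem_torusU_isRegularElt L v
  have hZ : Subgroup.centralizer ({t₀} : Set ↥(unitaryGroupOfForm (conjLocal L (IsCMField.complexConj L) v) (cmLocalForm L 3 v))) = (cmBorelTriple L 3 v).M := centralizer_eq_cmTorus_of_isRegularElt L v ht₀ hreg₀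
  -- the `«local»` carrier IS this one: hand it the σ-algebra
  letI : MeasurableSpace ↥(«local» L (IsCMField.complexConj L) 3 (Matrix.of fun i j : Fin 3 => if i.val + j.val + 1 = 3 then (1 : L) else 0) v) := ‹MeasurableSpace ↥(unitaryGroupOfForm (conjLocal L (IsCMField.complexConj L) v) (cmLocalForm L 3 v))›
  haveI : BorelSpace ↥(«local» L (IsCMField.complexConj L) 3 (Matrix.of fun i j : Fin 3 => if i.val + j.val + 1 = 3 then (1 : L) else 0) v) := ‹BorelSpace ↥(unitaryGroupOfForm (conjLocal L (IsCMField.complexConj L) v) (cmLocalForm L 3 v))›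
  have h : ∃ tZ : Measure ↥(Subgroup.centralizer ({t₀} : Set ↥(unitaryGroupOfForm (conjLocal L (IsCMField.complexConj L) v) (cmLocalForm L 3 v)))),
      tZ.IsHaarMeasure ∧ tZ.IsInvInvariant ∧ tZ (compactCore ↥(Subgroup.centralizer ({t₀} : Set ↥(unitaryGroupOfForm (conjLocal L (IsCMField.complexConj L) v) (cmLocalForm L 3 v))))) = 1 :=
    forall_isRegularElt_exists_isHaarMeasure_compactCore_centralizer_local_eq_one (IsCMField.complexConj L) 3
      (Matrix.of fun i j : Fin 3 => if i.val + j.val + 1 = 3 then (1 : L) else 0) (IsCMField.complexConj_ne_one L) (antidiagOne_map_transpose (IsCMField.complexConj L) 3)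
      (isUnit_antidiagOne_det L 3) t₀ hreg₀
  rw [hZ] at h
  exact h

set_option maxHeartbeats 800000 in
-- instance-term unification at the CM carrier (`quotientMeasure` ∕ canonical family), cf. ★ p849841
/-- **CANONICAL ORBITAL INTEGRAL AT A REGULAR `t ∈ T` = FIBRE INTEGRAL OF THE CONJUGATION FAMILY** (every finite `v`): for `mQv` canonical for the regular
classes (★ `IsCanonical`, the organ's `hcanQ`), `tT` THE Haar measure of `T` with `tT(compactCore T) = 1`, `t ∈ T^{reg}` and `φ` measurable:
**`classOrbitalIntegral mQv φ ⟦t⟧ = ∫_{G ⧸ T} φ(Φ(q, t)) d(ν∕tT)(q)`** — ★ `IsCanonical.classOrbitalIntegral_mk_eq_orbitalIntegral'` with the canonical torus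
measure of `Z(t)` (★ exists), which read on `T = Z(t)` IS `tT` (★ `eq_of_apply_compactCore_eq_one`, ★ `image_compactCore`), then §1.
[cite: Rogawski1990, §4.3 (4.3.1) p. 43; §4.9 p. 54; §12.5 p. 182] [cite: DeitmarEchterhoff2014, Thm. 1.5.3] -/
theorem classOrbitalIntegral_mk_eq_integral_conjFamily
    [MeasurableSpace ↥(unitaryGroupOfForm (conjLocal L (IsCMField.complexConj L) v) (cmLocalForm L 3 v))] [BorelSpace ↥(unitaryGroupOfForm (conjLocal L (IsCMField.complexConj L) v) (cmLocalForm L 3 v))] [LocallyCompactSpace ↥(unitaryGroupOfForm (conjLocal L (IsCMField.complexConj L) v) (cmLocalForm L 3 v))] [SecondCountableTopology ↥(unitaryGroupOfForm (conjLocal L (IsCMField.complexConj L) v) (cmLocalForm L 3 v))] [T2Space ↥(unitaryGroupOfForm (conjLocal L (IsCMField.complexConj L) v) (cmLocalForm L 3 v))]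
    [∀ γ : ↥(unitaryGroupOfForm (conjLocal L (IsCMField.complexConj L) v) (cmLocalForm L 3 v)), MeasurableSpace (↥(unitaryGroupOfForm (conjLocal L (IsCMField.complexConj L) v) (cmLocalForm L 3 v)) ⧸ Subgroup.centralizer ({γ} : Set ↥(unitaryGroupOfForm (conjLocal L (IsCMField.complexConj L) v) (cmLocalForm L 3 v))))] [∀ γ : ↥(unitaryGroupOfForm (conjLocal L (IsCMField.complexConj L) v) (cmLocalForm L 3 v)), BorelSpace (↥(unitaryGroupOfForm (conjLocal L (IsCMField.complexConj L) v) (cmLocalForm L 3 v)) ⧸ Subgroup.centralizer ({γ} : Set ↥(unitaryGroupOfForm (conjLocal L (IsCMField.complexConj L) v) (cmLocalForm L 3 v))))]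
    [MeasurableSpace (↥(unitaryGroupOfForm (conjLocal L (IsCMField.complexConj L) v) (cmLocalForm L 3 v)) ⧸ (cmBorelTriple L 3 v).M)] [BorelSpace (↥(unitaryGroupOfForm (conjLocal L (IsCMField.complexConj L) v) (cmLocalForm L 3 v)) ⧸ (cmBorelTriple L 3 v).M)]
    (ν : Measure ↥(unitaryGroupOfForm (conjLocal L (IsCMField.complexConj L) v) (cmLocalForm L 3 v))) [ν.IsHaarMeasure] [ν.IsMulRightInvariant]
    {mQv : OrbitalMeasureFamily ↥(unitaryGroupOfForm (conjLocal L (IsCMField.complexConj L) v) (cmLocalForm L 3 v))} (hcanQ : mQv.IsCanonical (fun γ => IsRegularElt (γ.val : GL (Fin 3) (LocalRing L v))) ν)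
    (tT : Measure ↥(cmBorelTriple L 3 v).M) [tT.IsHaarMeasure] [tT.IsInvInvariant] (htT : tT (compactCore ↥(cmBorelTriple L 3 v).M) = 1)
    (Φ : (↥(unitaryGroupOfForm (conjLocal L (IsCMField.complexConj L) v) (cmLocalForm L 3 v)) ⧸ (cmBorelTriple L 3 v).M) × ↥(cmBorelTriple L 3 v).M → ↥(unitaryGroupOfForm (conjLocal L (IsCMField.complexConj L) v) (cmLocalForm L 3 v))) (hΦ : ∀ (x : ↥(unitaryGroupOfForm (conjLocal L (IsCMField.complexConj L) v) (cmLocalForm L 3 v))) (t : ↥(cmBorelTriple L 3 v).M), Φ (QuotientGroup.mk x, t) = x * t * x⁻¹)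
    (t : ↥(cmBorelTriple L 3 v).M) (ht : IsRegularElt (((t : ↥(unitaryGroupOfForm (conjLocal L (IsCMField.complexConj L) v) (cmLocalForm L 3 v)))) : GL (Fin 3) (LocalRing L v))) (φ : ↥(unitaryGroupOfForm (conjLocal L (IsCMField.complexConj L) v) (cmLocalForm L 3 v)) → ℂ) (hφ : Measurable φ) :
    classOrbitalIntegral mQv φ (ConjClasses.mk (t : ↥(unitaryGroupOfForm (conjLocal L (IsCMField.complexConj L) v) (cmLocalForm L 3 v)))) = ∫ q, φ (Φ (q, t)) ∂(quotientMeasure (cmBorelTriple L 3 v).M tT (isClosed_cmBorelTriple_M L v) ν) := by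
  have hZeq : Subgroup.centralizer ({(t : ↥(unitaryGroupOfForm (conjLocal L (IsCMField.complexConj L) v) (cmLocalForm L 3 v)))} : Set ↥(unitaryGroupOfForm (conjLocal L (IsCMField.complexConj L) v) (cmLocalForm L 3 v))) = (cmBorelTriple L 3 v).M := centralizer_eq_cmTorus_of_isRegularElt L v t.2 ht
  have hZ : ∀ g : ↥(unitaryGroupOfForm (conjLocal L (IsCMField.complexConj L) v) (cmLocalForm L 3 v)), (MulEquiv.refl ↥(unitaryGroupOfForm (conjLocal L (IsCMField.complexConj L) v) (cmLocalForm L 3 v))) g ∈ (cmBorelTriple L 3 v).M ↔ g ∈ Subgroup.centralizer ({(t : ↥(unitaryGroupOfForm (conjLocal L (IsCMField.complexConj L) v) (cmLocalForm L 3 v)))} : Set ↥(unitaryGroupOfForm (conjLocal L (IsCMField.complexConj L) v) (cmLocalForm L 3 v))) := fun g => by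
    rw [MulEquiv.refl_apply, hZeq]
  letI : MeasurableSpace ↥(«local» L (IsCMField.complexConj L) 3 (Matrix.of fun i j : Fin 3 => if i.val + j.val + 1 = 3 then (1 : L) else 0) v) := ‹MeasurableSpace ↥(unitaryGroupOfForm (conjLocal L (IsCMField.complexConj L) v) (cmLocalForm L 3 v))›
  haveI : BorelSpace ↥(«local» L (IsCMField.complexConj L) 3 (Matrix.of fun i j : Fin 3 => if i.val + j.val + 1 = 3 then (1 : L) else 0) v) := ‹BorelSpace ↥(unitaryGroupOfForm (conjLocal L (IsCMField.complexConj L) v) (cmLocalForm L 3 v))›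
  have hexZ : ∃ tZ : Measure ↥(Subgroup.centralizer ({(t : ↥(unitaryGroupOfForm (conjLocal L (IsCMField.complexConj L) v) (cmLocalForm L 3 v)))} : Set ↥(unitaryGroupOfForm (conjLocal L (IsCMField.complexConj L) v) (cmLocalForm L 3 v)))),
      tZ.IsHaarMeasure ∧ tZ.IsInvInvariant ∧ tZ (compactCore ↥(Subgroup.centralizer ({(t : ↥(unitaryGroupOfForm (conjLocal L (IsCMField.complexConj L) v) (cmLocalForm L 3 v)))} : Set ↥(unitaryGroupOfForm (conjLocal L (IsCMField.complexConj L) v) (cmLocalForm L 3 v))))) = 1 :=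
    forall_isRegularElt_exists_isHaarMeasure_compactCore_centralizer_local_eq_one (IsCMField.complexConj L) 3
      (Matrix.of fun i j : Fin 3 => if i.val + j.val + 1 = 3 then (1 : L) else 0) (IsCMField.complexConj_ne_one L) (antidiagOne_map_transpose (IsCMField.complexConj L) 3)
      (isUnit_antidiagOne_det L 3) (t : ↥(unitaryGroupOfForm (conjLocal L (IsCMField.complexConj L) v) (cmLocalForm L 3 v))) ht
  obtain ⟨tZ, hZhaar, hZinv, hZone⟩ := hexZ
  haveI := hZhaar
  haveI := hZinv
  -- `tT` is `tZ` read on `T`: both are Haar measures on `T` with mass one on the compact core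
  set e := subgroupCongrHomeomorph (MulEquiv.refl ↥(unitaryGroupOfForm (conjLocal L (IsCMField.complexConj L) v) (cmLocalForm L 3 v))) (Subgroup.centralizer ({(t : ↥(unitaryGroupOfForm (conjLocal L (IsCMField.complexConj L) v) (cmLocalForm L 3 v)))} : Set ↥(unitaryGroupOfForm (conjLocal L (IsCMField.complexConj L) v) (cmLocalForm L 3 v)))) (cmBorelTriple L 3 v).M hZ continuous_id continuous_id with he
  obtain ⟨e', hee'⟩ : ∃ e' : ↥(Subgroup.centralizer ({(t : ↥(unitaryGroupOfForm (conjLocal L (IsCMField.complexConj L) v) (cmLocalForm L 3 v)))} : Set ↥(unitaryGroupOfForm (conjLocal L (IsCMField.complexConj L) v) (cmLocalForm L 3 v)))) ≃ₜ* ↥(cmBorelTriple L 3 v).M,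
      (⇑e : ↥(Subgroup.centralizer ({(t : ↥(unitaryGroupOfForm (conjLocal L (IsCMField.complexConj L) v) (cmLocalForm L 3 v)))} : Set ↥(unitaryGroupOfForm (conjLocal L (IsCMField.complexConj L) v) (cmLocalForm L 3 v)))) → ↥(cmBorelTriple L 3 v).M) = ⇑e' :=
    ⟨{ MulEquiv.subgroupCongr hZeq with continuous_toFun := e.continuous, continuous_invFun := e.symm.continuous }, rfl⟩
  haveI : LocallyCompactSpace ↥(cmBorelTriple L 3 v).M := (isClosed_cmBorelTriple_M L v).isClosedEmbedding_subtypeVal.locallyCompactSpace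
  haveI : SecondCountableTopology ↥(cmBorelTriple L 3 v).M := TopologicalSpace.Subtype.secondCountableTopology _
  haveI : (Measure.map e tZ).IsHaarMeasure := by rw [hee']; exact ContinuousMulEquiv.isHaarMeasure_map tZ e'
  have htZ : tT = Measure.map e tZ := by
    refine eq_of_apply_compactCore_eq_one tT _ htT ?_
    have hme : MeasurableEmbedding (⇑e') := e'.toHomeomorph.measurableEmbedding
    rw [hee', ← image_compactCore e', hme.map_apply]
    change tZ (e' ⁻¹' (e' '' compactCore ↥(Subgroup.centralizer ({(t : ↥(unitaryGroupOfForm (conjLocal L (IsCMField.complexConj L) v) (cmLocalForm L 3 v)))} : Set ↥(unitaryGroupOfForm (conjLocal L (IsCMField.complexConj L) v) (cmLocalForm L 3 v)))))) = 1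
    rwa [e'.injective.preimage_image]
  have hconj : ∀ g x : ↥(unitaryGroupOfForm (conjLocal L (IsCMField.complexConj L) v) (cmLocalForm L 3 v)), IsRegularElt (g : GL (Fin 3) (LocalRing L v)) → IsRegularElt ((x * g * x⁻¹ : ↥(unitaryGroupOfForm (conjLocal L (IsCMField.complexConj L) v) (cmLocalForm L 3 v))) : GL (Fin 3) (LocalRing L v)) :=
    fun g x hg => (isRegularElt_coe_conj_iff (conjLocal L (IsCMField.complexConj L) v) (cmLocalForm L 3 v) x g).2 hg
  have hco := hcanQ.classOrbitalIntegral_mk_eq_orbitalIntegral' hconj ht tZ hZone φ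
  rw [hco]
  exact orbitalIntegral_eq_integral_conjFamily_of_centralizer_eq (cmBorelTriple L 3 v).M (isClosed_cmBorelTriple_M L v) ν tT Φ hΦ t hZ tZ htZ φ hφ

/-! ## §3 «(WIF-σ)»: the Weyl integration formula on `hyperbolicSet L v` against canonical orbital integrals and a radial measure -/

/-- **★ `hyperbolicSet L v` IS the hyperbolic set `Ω` of ★ p849733 ∕ ★ (B1)** (`IsConj t g ↔ ∃ c, c t c⁻¹ = g`). [cite: Rogawski1990, §12.5 p. 182] -/
theorem hyperbolicSet_eq_hypSet :
    (hyperbolicSet L v : Set ↥(unitaryGroupOfForm (conjLocal L (IsCMField.complexConj L) v) (cmLocalForm L 3 v))) = {x | ∃ g t : ↥(unitaryGroupOfForm (conjLocal L (IsCMField.complexConj L) v) (cmLocalForm L 3 v)), t ∈ (cmBorelTriple L 3 v).M ∧ IsRegularElt (t : GL (Fin 3) (LocalRing L v)) ∧ g * t * g⁻¹ = x} := by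
  ext x
  constructor
  · rintro ⟨t, hreg, hconj⟩
    obtain ⟨c, hc⟩ := isConj_iff.1 hconj
    exact ⟨c, t, t.2, hreg, hc⟩
  · rintro ⟨g, t, htT, hreg, h⟩
    exact ⟨⟨t, htT⟩, hreg, isConj_iff.2 ⟨g, h⟩⟩

set_option maxHeartbeats 800000 in
set_option synthInstance.maxHeartbeats 400000 in
-- instance-term unification at the CM carrier (`quotientMeasure` ∕ canonical family), cf. ★ p849841
/-- **«(WIF-σ)» — THE WEYL INTEGRATION FORMULA ON THE HYPERBOLIC SET AGAINST CANONICAL ORBITAL INTEGRALS, RADIAL FORM** (`v` non-split; `ν` Haar on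
`G = U(Φ₃)(L⁺_v)`, `mQv` canonical for the regular classes).  There is a measure `σ′` on the split torus `T`, finite on compact sets, σ-finite, carried by
`T^{reg}`, such that for every measurable `φ, α : G → ℂ` with `α` conjugation invariant on `Ω = hyperbolicSet L v`, `φ·α` ν-integrable on `Ω` and `φ = 0` off `Ω`:
the radial integrand `t ↦ classOrbitalIntegral mQv φ ⟦t⟧ · α(t)` is `σ′`-integrable and **`∫_G φ·α dν = ∫_T classOrbitalIntegral mQv φ ⟦t⟧ · α(t) dσ′(t)`** —
★ p849733 `exists_radialMeasure_integral_hypSet` at THE normalised Haar measure `tT` of `T` (§2), the inner fibre integral being `α(t) · O^{can}_t(φ)` (conjugation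
invariance of `α`, §2 `classOrbitalIntegral_mk_eq_integral_conjFamily`), `σ′ = ½ σ`.  (W-b) of the (TOR) road WITH A RADIAL MEASURE; the density form
`dσ′ = ρ dμ` is the Jacobian input (★ p849811, conditional) and is NOT asserted. [cite: Rogawski1990, §12.5 p. 182] [cite: HarishChandra1970, Lemma 42]
[cite: DeitmarEchterhoff2014, Thm. 1.5.3] -/
theorem exists_radialMeasure_integral_mul_classFun
    (hns : ∀ w : PlacesOver L v, IsCMField.complexConj L • w.1 = w.1)
    [MeasurableSpace ↥(unitaryGroupOfForm (conjLocal L (IsCMField.complexConj L) v) (cmLocalForm L 3 v))] [BorelSpace ↥(unitaryGroupOfForm (conjLocal L (IsCMField.complexConj L) v) (cmLocalForm L 3 v))] [LocallyCompactSpace ↥(unitaryGroupOfForm (conjLocal L (IsCMField.complexConj L) v) (cmLocalForm L 3 v))] [SecondCountableTopology ↥(unitaryGroupOfForm (conjLocal L (IsCMField.complexConj L) v) (cmLocalForm L 3 v))] [T2Space ↥(unitaryGroupOfForm (conjLocal L (IsCMField.complexConj L) v) (cmLocalForm L 3 v))]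
    [∀ γ : ↥(unitaryGroupOfForm (conjLocal L (IsCMField.complexConj L) v) (cmLocalForm L 3 v)), MeasurableSpace (↥(unitaryGroupOfForm (conjLocal L (IsCMField.complexConj L) v) (cmLocalForm L 3 v)) ⧸ Subgroup.centralizer ({γ} : Set ↥(unitaryGroupOfForm (conjLocal L (IsCMField.complexConj L) v) (cmLocalForm L 3 v))))] [∀ γ : ↥(unitaryGroupOfForm (conjLocal L (IsCMField.complexConj L) v) (cmLocalForm L 3 v)), BorelSpace (↥(unitaryGroupOfForm (conjLocal L (IsCMField.complexConj L) v) (cmLocalForm L 3 v)) ⧸ Subgroup.centralizer ({γ} : Set ↥(unitaryGroupOfForm (conjLocal L (IsCMField.complexConj L) v) (cmLocalForm L 3 v))))]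
    (ν : Measure ↥(unitaryGroupOfForm (conjLocal L (IsCMField.complexConj L) v) (cmLocalForm L 3 v))) [ν.IsHaarMeasure] [ν.IsMulRightInvariant]
    {mQv : OrbitalMeasureFamily ↥(unitaryGroupOfForm (conjLocal L (IsCMField.complexConj L) v) (cmLocalForm L 3 v))} (hcanQ : mQv.IsCanonical (fun γ => IsRegularElt (γ.val : GL (Fin 3) (LocalRing L v))) ν) :
    ∃ σ' : Measure ↥(cmBorelTriple L 3 v).M, IsFiniteMeasureOnCompacts σ' ∧ SigmaFinite σ' ∧
      σ' {t : ↥(cmBorelTriple L 3 v).M | ¬ IsRegularElt (((t : ↥(unitaryGroupOfForm (conjLocal L (IsCMField.complexConj L) v) (cmLocalForm L 3 v)))) : GL (Fin 3) (LocalRing L v))} = 0 ∧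
      ∀ φ α : ↥(unitaryGroupOfForm (conjLocal L (IsCMField.complexConj L) v) (cmLocalForm L 3 v)) → ℂ, Measurable φ → Measurable α →
        (∀ x : ↥(unitaryGroupOfForm (conjLocal L (IsCMField.complexConj L) v) (cmLocalForm L 3 v)), x ∈ (hyperbolicSet L v : Set ↥(unitaryGroupOfForm (conjLocal L (IsCMField.complexConj L) v) (cmLocalForm L 3 v))) → ∀ h : ↥(unitaryGroupOfForm (conjLocal L (IsCMField.complexConj L) v) (cmLocalForm L 3 v)), α (h * x * h⁻¹) = α x) →
        IntegrableOn (fun x => φ x * α x) (hyperbolicSet L v : Set ↥(unitaryGroupOfForm (conjLocal L (IsCMField.complexConj L) v) (cmLocalForm L 3 v))) ν →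
        (∀ x : ↥(unitaryGroupOfForm (conjLocal L (IsCMField.complexConj L) v) (cmLocalForm L 3 v)), x ∉ (hyperbolicSet L v : Set ↥(unitaryGroupOfForm (conjLocal L (IsCMField.complexConj L) v) (cmLocalForm L 3 v))) → φ x = 0) →
          Integrable (fun t : ↥(cmBorelTriple L 3 v).M => classOrbitalIntegral mQv φ (ConjClasses.mk (t : ↥(unitaryGroupOfForm (conjLocal L (IsCMField.complexConj L) v) (cmLocalForm L 3 v)))) * α t) σ' ∧
            ∫ x, φ x * α x ∂ν = ∫ t : ↥(cmBorelTriple L 3 v).M, classOrbitalIntegral mQv φ (ConjClasses.mk (t : ↥(unitaryGroupOfForm (conjLocal L (IsCMField.complexConj L) v) (cmLocalForm L 3 v)))) * α t ∂σ' := by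
  classical
  -- the Borel σ-algebra on `G ⧸ T` (internal), the normalised Haar measure of `T`, the conjugation family
  letI : MeasurableSpace (↥(unitaryGroupOfForm (conjLocal L (IsCMField.complexConj L) v) (cmLocalForm L 3 v)) ⧸ (cmBorelTriple L 3 v).M) := borel _
  haveI : BorelSpace (↥(unitaryGroupOfForm (conjLocal L (IsCMField.complexConj L) v) (cmLocalForm L 3 v)) ⧸ (cmBorelTriple L 3 v).M) := ⟨rfl⟩
  have hT := isClosed_cmBorelTriple_M L v
  haveI := hT
  haveI : SecondCountableTopology (↥(unitaryGroupOfForm (conjLocal L (IsCMField.complexConj L) v) (cmLocalForm L 3 v)) ⧸ (cmBorelTriple L 3 v).M) := (QuotientGroup.isQuotientMap_mk _).secondCountableTopology QuotientGroup.isOpenMap_coe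
  haveI : LocallyCompactSpace (↥(unitaryGroupOfForm (conjLocal L (IsCMField.complexConj L) v) (cmLocalForm L 3 v)) ⧸ (cmBorelTriple L 3 v).M) := QuotientGroup.instLocallyCompactSpace _
  haveI : SigmaCompactSpace (↥(unitaryGroupOfForm (conjLocal L (IsCMField.complexConj L) v) (cmLocalForm L 3 v)) ⧸ (cmBorelTriple L 3 v).M) := sigmaCompactSpace_of_locallyCompact_secondCountable
  have hTc : ∀ a ∈ (cmBorelTriple L 3 v).M, ∀ b ∈ (cmBorelTriple L 3 v).M, a * b = b * a := fun a ha b hb => mul_comm_of_mem_torusU_cmLocal L v ha hb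
  obtain ⟨tT, htH, htI, ht1⟩ := exists_haar_cmTorus_compactCore_eq_one L v
  haveI := htH
  haveI := htI
  haveI : SigmaFinite (quotientMeasure (cmBorelTriple L 3 v).M tT (isClosed_cmBorelTriple_M L v) ν) := SigmaFinite.of_isFiniteMeasureOnCompacts _
  obtain ⟨Φ, hΦ⟩ := exists_conjFamily (cmBorelTriple L 3 v).M hTc
  obtain ⟨σ, hfin, hsf, hcar, -, -, hboch⟩ := exists_radialMeasure_integral_hypSet L v hns ν tT Φ hΦ
  haveI := hfin
  haveI := hsf
  have hΩ := hyperbolicSet_eq_hypSet L v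
  refine ⟨((2 : ℝ≥0)⁻¹) • σ, inferInstance, inferInstance, ?_, fun φ α hφm hαm hαinv hint hφ0 => ?_⟩
  · simp only [Measure.smul_apply, smul_eq_zero]
    exact Or.inr hcar
  -- the inner fibre integral at a regular `t` is `α(t) · O^{can}_t(φ)`
  have hinner : ∀ t : ↥(cmBorelTriple L 3 v).M, IsRegularElt (((t : ↥(unitaryGroupOfForm (conjLocal L (IsCMField.complexConj L) v) (cmLocalForm L 3 v)))) : GL (Fin 3) (LocalRing L v)) →
      ∫ q, φ (Φ (q, t)) * α (Φ (q, t)) ∂(quotientMeasure (cmBorelTriple L 3 v).M tT (isClosed_cmBorelTriple_M L v) ν) =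
        classOrbitalIntegral mQv φ (ConjClasses.mk (t : ↥(unitaryGroupOfForm (conjLocal L (IsCMField.complexConj L) v) (cmLocalForm L 3 v)))) * α t := by
    intro t ht
    have htΩ : (t : ↥(unitaryGroupOfForm (conjLocal L (IsCMField.complexConj L) v) (cmLocalForm L 3 v))) ∈ (hyperbolicSet L v : Set ↥(unitaryGroupOfForm (conjLocal L (IsCMField.complexConj L) v) (cmLocalForm L 3 v))) := by
      rw [hΩ]; exact mem_hypSet_of_mem_torusU (conjLocal L (IsCMField.complexConj L) v) (cmLocalForm L 3 v) t.2 ht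
    have hpt : ∀ q, φ (Φ (q, t)) * α (Φ (q, t)) = φ (Φ (q, t)) * α t := by
      intro q
      induction q using QuotientGroup.induction_on with
      | H x => rw [hΦ, hαinv _ htΩ x]
    rw [integral_congr_ae (Eventually.of_forall hpt), integral_mul_const,
      classOrbitalIntegral_mk_eq_integral_conjFamily L v ν hcanQ tT ht1 Φ hΦ t ht φ hφm]
  have hae : (fun t : ↥(cmBorelTriple L 3 v).M => ∫ q, φ (Φ (q, t)) * α (Φ (q, t)) ∂(quotientMeasure (cmBorelTriple L 3 v).M tT (isClosed_cmBorelTriple_M L v) ν)) =ᵐ[σ]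
      fun t => classOrbitalIntegral mQv φ (ConjClasses.mk (t : ↥(unitaryGroupOfForm (conjLocal L (IsCMField.complexConj L) v) (cmLocalForm L 3 v)))) * α t := by
    have hreg : ∀ᵐ t : ↥(cmBorelTriple L 3 v).M ∂σ, IsRegularElt (((t : ↥(unitaryGroupOfForm (conjLocal L (IsCMField.complexConj L) v) (cmLocalForm L 3 v)))) : GL (Fin 3) (LocalRing L v)) := by
      rw [ae_iff]; exact hcar
    filter_upwards [hreg] with t ht using hinner t ht
  rw [← hΩ] at hboch
  obtain ⟨hintg, heq⟩ := hboch (fun x => φ x * α x) hint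
  have hL : Integrable (fun t : ↥(cmBorelTriple L 3 v).M => ∫ q, φ (Φ (q, t)) * α (Φ (q, t)) ∂(quotientMeasure (cmBorelTriple L 3 v).M tT (isClosed_cmBorelTriple_M L v) ν)) σ :=
    hintg.integral_prod_left
  refine ⟨((hL.congr hae).smul_measure (by simp)), ?_⟩
  rw [integral_smul_nnreal_measure, ← integral_congr_ae hae, heq,
    setIntegral_eq_integral_of_forall_compl_eq_zero fun x hx => by rw [hφ0 x hx, zero_mul],
    NNReal.smul_def, NNReal.coe_inv, NNReal.coe_ofNat, smul_smul, inv_mul_cancel₀ (two_ne_zero' ℝ), one_smul]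

/-- **«(WIF-σ)» ON THE PARAMETER TORUS `M = E_vˣ × E¹_v`** (the road's shape, ★ `torusChartEquiv` ∕ `torusChart` = `ι`): with `σ_M := (torusChartEquiv L v)⁻¹_* σ′`,
for the same `φ, α`: **`∫_G φ·α dν = ∫_M classOrbitalIntegral mQv φ ⟦ι m⟧ · α(ι m) dσ_M(m)`**, `σ_M` finite on compact sets and carried by the regular points.
[cite: Rogawski1990, §12.5 p. 182; §12.7 L. 12.7.2 (proof) p. 193] [cite: HarishChandra1970, Lemma 42] -/
theorem exists_radialMeasure_integral_mul_classFun_param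
    (hns : ∀ w : PlacesOver L v, IsCMField.complexConj L • w.1 = w.1)
    [MeasurableSpace ↥(unitaryGroupOfForm (conjLocal L (IsCMField.complexConj L) v) (cmLocalForm L 3 v))] [BorelSpace ↥(unitaryGroupOfForm (conjLocal L (IsCMField.complexConj L) v) (cmLocalForm L 3 v))] [LocallyCompactSpace ↥(unitaryGroupOfForm (conjLocal L (IsCMField.complexConj L) v) (cmLocalForm L 3 v))] [SecondCountableTopology ↥(unitaryGroupOfForm (conjLocal L (IsCMField.complexConj L) v) (cmLocalForm L 3 v))] [T2Space ↥(unitaryGroupOfForm (conjLocal L (IsCMField.complexConj L) v) (cmLocalForm L 3 v))]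
    [∀ γ : ↥(unitaryGroupOfForm (conjLocal L (IsCMField.complexConj L) v) (cmLocalForm L 3 v)), MeasurableSpace (↥(unitaryGroupOfForm (conjLocal L (IsCMField.complexConj L) v) (cmLocalForm L 3 v)) ⧸ Subgroup.centralizer ({γ} : Set ↥(unitaryGroupOfForm (conjLocal L (IsCMField.complexConj L) v) (cmLocalForm L 3 v))))] [∀ γ : ↥(unitaryGroupOfForm (conjLocal L (IsCMField.complexConj L) v) (cmLocalForm L 3 v)), BorelSpace (↥(unitaryGroupOfForm (conjLocal L (IsCMField.complexConj L) v) (cmLocalForm L 3 v)) ⧸ Subgroup.centralizer ({γ} : Set ↥(unitaryGroupOfForm (conjLocal L (IsCMField.complexConj L) v) (cmLocalForm L 3 v))))]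
    [MeasurableSpace ((LocalRing L v)ˣ × ↥(normOneUnits (conjLocal L (IsCMField.complexConj L) v)))] [BorelSpace ((LocalRing L v)ˣ × ↥(normOneUnits (conjLocal L (IsCMField.complexConj L) v)))]
    (ν : Measure ↥(unitaryGroupOfForm (conjLocal L (IsCMField.complexConj L) v) (cmLocalForm L 3 v))) [ν.IsHaarMeasure] [ν.IsMulRightInvariant]
    {mQv : OrbitalMeasureFamily ↥(unitaryGroupOfForm (conjLocal L (IsCMField.complexConj L) v) (cmLocalForm L 3 v))} (hcanQ : mQv.IsCanonical (fun γ => IsRegularElt (γ.val : GL (Fin 3) (LocalRing L v))) ν) :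
    ∃ σM : Measure ((LocalRing L v)ˣ × ↥(normOneUnits (conjLocal L (IsCMField.complexConj L) v))), IsFiniteMeasureOnCompacts σM ∧
      σM {m | ¬ IsRegularElt ((((torusChart L v m : ↥(cmBorelTriple L 3 v).M) : ↥(unitaryGroupOfForm (conjLocal L (IsCMField.complexConj L) v) (cmLocalForm L 3 v)))) : GL (Fin 3) (LocalRing L v))} = 0 ∧
      ∀ φ α : ↥(unitaryGroupOfForm (conjLocal L (IsCMField.complexConj L) v) (cmLocalForm L 3 v)) → ℂ, Measurable φ → Measurable α →
        (∀ x : ↥(unitaryGroupOfForm (conjLocal L (IsCMField.complexConj L) v) (cmLocalForm L 3 v)), x ∈ (hyperbolicSet L v : Set ↥(unitaryGroupOfForm (conjLocal L (IsCMField.complexConj L) v) (cmLocalForm L 3 v))) → ∀ h : ↥(unitaryGroupOfForm (conjLocal L (IsCMField.complexConj L) v) (cmLocalForm L 3 v)), α (h * x * h⁻¹) = α x) →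
        IntegrableOn (fun x => φ x * α x) (hyperbolicSet L v : Set ↥(unitaryGroupOfForm (conjLocal L (IsCMField.complexConj L) v) (cmLocalForm L 3 v))) ν →
        (∀ x : ↥(unitaryGroupOfForm (conjLocal L (IsCMField.complexConj L) v) (cmLocalForm L 3 v)), x ∉ (hyperbolicSet L v : Set ↥(unitaryGroupOfForm (conjLocal L (IsCMField.complexConj L) v) (cmLocalForm L 3 v))) → φ x = 0) →
          ∫ x, φ x * α x ∂ν =
            ∫ m, classOrbitalIntegral mQv φ (ConjClasses.mk (((torusChart L v m : ↥(cmBorelTriple L 3 v).M) : ↥(unitaryGroupOfForm (conjLocal L (IsCMField.complexConj L) v) (cmLocalForm L 3 v))))) * α ((torusChart L v m : ↥(cmBorelTriple L 3 v).M) : ↥(unitaryGroupOfForm (conjLocal L (IsCMField.complexConj L) v) (cmLocalForm L 3 v))) ∂σM := by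
  obtain ⟨σ', hfin, hsf, hcar, hmain⟩ := exists_radialMeasure_integral_mul_classFun L v hns ν hcanQ
  haveI := hfin
  let e : ↥(cmBorelTriple L 3 v).M ≃ₜ ((LocalRing L v)ˣ × ↥(normOneUnits (conjLocal L (IsCMField.complexConj L) v))) := (torusChartEquiv L v).symm.toHomeomorph
  refine ⟨Measure.map e σ', IsFiniteMeasureOnCompacts.map σ' e, ?_, fun φ α hφm hαm hαinv hint hφ0 => ?_⟩
  · rw [e.measurableEmbedding.map_apply]
    convert hcar using 2
    ext t
    simp only [mem_preimage, mem_setOf_eq]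
    rw [show torusChart L v (e t) = t from (torusChartEquiv L v).apply_symm_apply t]
  · rw [(hmain φ α hφm hαm hαinv hint hφ0).2, e.measurableEmbedding.integral_map]
    refine integral_congr_ae (Eventually.of_forall fun t => ?_)
    simp only
    rw [show torusChart L v (e t) = t from (torusChartEquiv L v).apply_symm_apply t]

/-! ## §4 (ED. 2) The same in the LEAF's binder shape: `α` locally integrable, `φ ∈ C_c^∞` supported in `hyperbolicSet L v` -/

/-- **«(WIF-σ)» IN THE (TOR″)∕(WIF) BINDER SHAPE OF ★ p849901 `…SaHeadTorus3`** (`v` non-split): a measure `σ′` on `T` (finite on compacts, σ-finite, carried by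
`T^{reg}`) such that for every measurable, locally `ν`-integrable `α` that is conjugation invariant on `hyperbolicSet L v` and every `φ` with `IsLocSmooth φ` and
`tsupport φ ⊆ hyperbolicSet L v`: **`∫ φ·α dν = ∫_T classOrbitalIntegral mQv φ ⟦t⟧ · α(t) dσ′`** (and the radial integrand is `σ′`-integrable) — §3 with the analytic
hypotheses discharged by Mathlib's `LocallyIntegrable.integrable_smul_left_of_hasCompactSupport` and `image_eq_zero_of_notMem_tsupport`.  (Density form
`dσ′ = ρ dμ` ⟸ the tube Jacobian, ★ p849811 — not asserted.) [cite: Rogawski1990, §12.5 p. 182; §1.6 p. 6] [cite: HarishChandra1970, Lemma 42] -/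
theorem exists_radialMeasure_wif
    (hns : ∀ w : PlacesOver L v, IsCMField.complexConj L • w.1 = w.1)
    [MeasurableSpace ↥(unitaryGroupOfForm (conjLocal L (IsCMField.complexConj L) v) (cmLocalForm L 3 v))] [BorelSpace ↥(unitaryGroupOfForm (conjLocal L (IsCMField.complexConj L) v) (cmLocalForm L 3 v))] [LocallyCompactSpace ↥(unitaryGroupOfForm (conjLocal L (IsCMField.complexConj L) v) (cmLocalForm L 3 v))] [SecondCountableTopology ↥(unitaryGroupOfForm (conjLocal L (IsCMField.complexConj L) v) (cmLocalForm L 3 v))] [T2Space ↥(unitaryGroupOfForm (conjLocal L (IsCMField.complexConj L) v) (cmLocalForm L 3 v))]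
    [∀ γ : ↥(unitaryGroupOfForm (conjLocal L (IsCMField.complexConj L) v) (cmLocalForm L 3 v)), MeasurableSpace (↥(unitaryGroupOfForm (conjLocal L (IsCMField.complexConj L) v) (cmLocalForm L 3 v)) ⧸ Subgroup.centralizer ({γ} : Set ↥(unitaryGroupOfForm (conjLocal L (IsCMField.complexConj L) v) (cmLocalForm L 3 v))))] [∀ γ : ↥(unitaryGroupOfForm (conjLocal L (IsCMField.complexConj L) v) (cmLocalForm L 3 v)), BorelSpace (↥(unitaryGroupOfForm (conjLocal L (IsCMField.complexConj L) v) (cmLocalForm L 3 v)) ⧸ Subgroup.centralizer ({γ} : Set ↥(unitaryGroupOfForm (conjLocal L (IsCMField.complexConj L) v) (cmLocalForm L 3 v))))]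
    (ν : Measure ↥(unitaryGroupOfForm (conjLocal L (IsCMField.complexConj L) v) (cmLocalForm L 3 v))) [ν.IsHaarMeasure] [ν.IsMulRightInvariant]
    {mQv : OrbitalMeasureFamily ↥(unitaryGroupOfForm (conjLocal L (IsCMField.complexConj L) v) (cmLocalForm L 3 v))} (hcanQ : mQv.IsCanonical (fun γ => IsRegularElt (γ.val : GL (Fin 3) (LocalRing L v))) ν) :
    ∃ σ' : Measure ↥(cmBorelTriple L 3 v).M, IsFiniteMeasureOnCompacts σ' ∧ SigmaFinite σ' ∧
      σ' {t : ↥(cmBorelTriple L 3 v).M | ¬ IsRegularElt (((t : ↥(unitaryGroupOfForm (conjLocal L (IsCMField.complexConj L) v) (cmLocalForm L 3 v)))) : GL (Fin 3) (LocalRing L v))} = 0 ∧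
      ∀ α : ↥(unitaryGroupOfForm (conjLocal L (IsCMField.complexConj L) v) (cmLocalForm L 3 v)) → ℂ, Measurable α → LocallyIntegrable α ν →
        (∀ x : ↥(unitaryGroupOfForm (conjLocal L (IsCMField.complexConj L) v) (cmLocalForm L 3 v)), x ∈ (hyperbolicSet L v : Set ↥(unitaryGroupOfForm (conjLocal L (IsCMField.complexConj L) v) (cmLocalForm L 3 v))) → ∀ h : ↥(unitaryGroupOfForm (conjLocal L (IsCMField.complexConj L) v) (cmLocalForm L 3 v)), α (h * x * h⁻¹) = α x) →
        ∀ φ : ↥(unitaryGroupOfForm (conjLocal L (IsCMField.complexConj L) v) (cmLocalForm L 3 v)) → ℂ, IsLocSmooth φ → tsupport φ ⊆ (hyperbolicSet L v : Set ↥(unitaryGroupOfForm (conjLocal L (IsCMField.complexConj L) v) (cmLocalForm L 3 v))) →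
          Integrable (fun t : ↥(cmBorelTriple L 3 v).M => classOrbitalIntegral mQv φ (ConjClasses.mk (t : ↥(unitaryGroupOfForm (conjLocal L (IsCMField.complexConj L) v) (cmLocalForm L 3 v)))) * α t) σ' ∧
            ∫ x, φ x * α x ∂ν = ∫ t : ↥(cmBorelTriple L 3 v).M, classOrbitalIntegral mQv φ (ConjClasses.mk (t : ↥(unitaryGroupOfForm (conjLocal L (IsCMField.complexConj L) v) (cmLocalForm L 3 v)))) * α t ∂σ' := by
  obtain ⟨σ', hfin, hsf, hcar, hmain⟩ := exists_radialMeasure_integral_mul_classFun L v hns ν hcanQ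
  refine ⟨σ', hfin, hsf, hcar, fun α hαm hαli hαinv φ hφ hsupp => ?_⟩
  have hint : IntegrableOn (fun x => φ x * α x) (hyperbolicSet L v : Set ↥(unitaryGroupOfForm (conjLocal L (IsCMField.complexConj L) v) (cmLocalForm L 3 v))) ν := by
    have h := hαli.integrable_smul_left_of_hasCompactSupport hφ.continuous hφ.hasCompactSupport
    simp only [smul_eq_mul] at h
    exact h.integrableOn
  exact hmain φ α hφ.continuous.measurable hαm hαinv hint fun x hx => image_eq_zero_of_notMem_tsupport fun h => hx (hsupp h)

/-- **«(WIF-σ)» IN THE LEAF's SHAPE ON THE PARAMETER TORUS `M`** (integration variable `m : E_vˣ × E¹_v`, `ι = torusChart L v`, as in (TOR″)'s right-hand side):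
`∫ φ·α dν = ∫_M classOrbitalIntegral mQv φ ⟦ι m⟧ · α(ι m) dσ_M(m)`. [cite: Rogawski1990, §12.5 p. 182; §12.7 L. 12.7.2 (proof) p. 193] [cite: HarishChandra1970, Lemma 42] -/
theorem exists_radialMeasure_wif_param
    (hns : ∀ w : PlacesOver L v, IsCMField.complexConj L • w.1 = w.1)
    [MeasurableSpace ↥(unitaryGroupOfForm (conjLocal L (IsCMField.complexConj L) v) (cmLocalForm L 3 v))] [BorelSpace ↥(unitaryGroupOfForm (conjLocal L (IsCMField.complexConj L) v) (cmLocalForm L 3 v))] [LocallyCompactSpace ↥(unitaryGroupOfForm (conjLocal L (IsCMField.complexConj L) v) (cmLocalForm L 3 v))] [SecondCountableTopology ↥(unitaryGroupOfForm (conjLocal L (IsCMField.complexConj L) v) (cmLocalForm L 3 v))] [T2Space ↥(unitaryGroupOfForm (conjLocal L (IsCMField.complexConj L) v) (cmLocalForm L 3 v))]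
    [∀ γ : ↥(unitaryGroupOfForm (conjLocal L (IsCMField.complexConj L) v) (cmLocalForm L 3 v)), MeasurableSpace (↥(unitaryGroupOfForm (conjLocal L (IsCMField.complexConj L) v) (cmLocalForm L 3 v)) ⧸ Subgroup.centralizer ({γ} : Set ↥(unitaryGroupOfForm (conjLocal L (IsCMField.complexConj L) v) (cmLocalForm L 3 v))))] [∀ γ : ↥(unitaryGroupOfForm (conjLocal L (IsCMField.complexConj L) v) (cmLocalForm L 3 v)), BorelSpace (↥(unitaryGroupOfForm (conjLocal L (IsCMField.complexConj L) v) (cmLocalForm L 3 v)) ⧸ Subgroup.centralizer ({γ} : Set ↥(unitaryGroupOfForm (conjLocal L (IsCMField.complexConj L) v) (cmLocalForm L 3 v))))]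
    [MeasurableSpace ((LocalRing L v)ˣ × ↥(normOneUnits (conjLocal L (IsCMField.complexConj L) v)))] [BorelSpace ((LocalRing L v)ˣ × ↥(normOneUnits (conjLocal L (IsCMField.complexConj L) v)))]
    (ν : Measure ↥(unitaryGroupOfForm (conjLocal L (IsCMField.complexConj L) v) (cmLocalForm L 3 v))) [ν.IsHaarMeasure] [ν.IsMulRightInvariant]
    {mQv : OrbitalMeasureFamily ↥(unitaryGroupOfForm (conjLocal L (IsCMField.complexConj L) v) (cmLocalForm L 3 v))} (hcanQ : mQv.IsCanonical (fun γ => IsRegularElt (γ.val : GL (Fin 3) (LocalRing L v))) ν) :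
    ∃ σM : Measure ((LocalRing L v)ˣ × ↥(normOneUnits (conjLocal L (IsCMField.complexConj L) v))), IsFiniteMeasureOnCompacts σM ∧
      σM {m | ¬ IsRegularElt ((((torusChart L v m : ↥(cmBorelTriple L 3 v).M) : ↥(unitaryGroupOfForm (conjLocal L (IsCMField.complexConj L) v) (cmLocalForm L 3 v)))) : GL (Fin 3) (LocalRing L v))} = 0 ∧
      ∀ α : ↥(unitaryGroupOfForm (conjLocal L (IsCMField.complexConj L) v) (cmLocalForm L 3 v)) → ℂ, Measurable α → LocallyIntegrable α ν →
        (∀ x : ↥(unitaryGroupOfForm (conjLocal L (IsCMField.complexConj L) v) (cmLocalForm L 3 v)), x ∈ (hyperbolicSet L v : Set ↥(unitaryGroupOfForm (conjLocal L (IsCMField.complexConj L) v) (cmLocalForm L 3 v))) → ∀ h : ↥(unitaryGroupOfForm (conjLocal L (IsCMField.complexConj L) v) (cmLocalForm L 3 v)), α (h * x * h⁻¹) = α x) →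
        ∀ φ : ↥(unitaryGroupOfForm (conjLocal L (IsCMField.complexConj L) v) (cmLocalForm L 3 v)) → ℂ, IsLocSmooth φ → tsupport φ ⊆ (hyperbolicSet L v : Set ↥(unitaryGroupOfForm (conjLocal L (IsCMField.complexConj L) v) (cmLocalForm L 3 v))) →
          ∫ x, φ x * α x ∂ν =
            ∫ m, classOrbitalIntegral mQv φ (ConjClasses.mk (((torusChart L v m : ↥(cmBorelTriple L 3 v).M) : ↥(unitaryGroupOfForm (conjLocal L (IsCMField.complexConj L) v) (cmLocalForm L 3 v))))) * α ((torusChart L v m : ↥(cmBorelTriple L 3 v).M) : ↥(unitaryGroupOfForm (conjLocal L (IsCMField.complexConj L) v) (cmLocalForm L 3 v))) ∂σM := by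
  obtain ⟨σM, hfin, hcar, hmain⟩ := exists_radialMeasure_integral_mul_classFun_param L v hns ν hcanQ
  refine ⟨σM, hfin, hcar, fun α hαm hαli hαinv φ hφ hsupp => ?_⟩
  have hint : IntegrableOn (fun x => φ x * α x) (hyperbolicSet L v : Set ↥(unitaryGroupOfForm (conjLocal L (IsCMField.complexConj L) v) (cmLocalForm L 3 v))) ν := by
    have h := hαli.integrable_smul_left_of_hasCompactSupport hφ.continuous hφ.hasCompactSupport
    simp only [smul_eq_mul] at h
    exact h.integrableOn
  exact hmain φ α hφ.continuous.measurable hαm hαinv hint fun x hx => image_eq_zero_of_notMem_tsupport fun h => hx (hsupp h)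

end CM

end Summit.HodgeConjecture.HodgeConjecture.Cruxes.H413.F0P3cStCharTSWeylHypWIF
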